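import Summits.QuantumAdvantage.AdviceFreeQNC0.CrossTeam
import HarnessLib

/-!
# Cell qa-qnc0 — `stub_crossToProduct`: the product game bounds the cross-team game (all `L, L'`)

Line `product` of the route crux `RingToElim` (planner qa-qnc0-p1) has the stub

  `stub_crossToProduct : ProductHardPolylog → CrossTeamHardPolylog`   ("three-mode XOR law",
  planner qa-qnc0-p2 ROUND-1 §9.26: `LOSE = F₀ Δ S₁`),

PROVED here for all block lengths with both bodies verbatim (`crossTeamHard_of_productHard`).
The law (`crossWin_iff_ne`, a 432-case check modulo `3`): with `V = {0, ω^{2(c+|u|+|v|)}}` (an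
`𝔽₂`-line in `𝔽₄`), the cell `(u,v)` is LOST iff `Λ₀ + ω^{|u|}Λ₁ ∈ V` iff `[Λ₀ ∈ V] = [ω^{|u|}Λ₁ ∈ V]`;
member 0's row-`u` success set `{v : Λ₀(u,v) ∉ V}` is the WIN pattern of the stakes-eliminator
`(a, b) = F₀ u` of class `2(c + |u|)` on block `L'` (`win0`), and member 1's column-`v` success set
is the WIN pattern of the stakes-eliminator `(a' ⊕ b', b')`, `(a', b') = F₁ v`, of class `c + |v|` on
block `L` (`win1`; the Frobenius twist `x ↦ x²` turns `ω^{|u|}` into `ω^{-|u|}`). Hence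
`crossWinCount + agreeCountR win1 win0 = 2^{L+L'}` (`crossWinCount_add_agree`) and `θ = 1 − μ`.

Vocabulary `IsElimWin`, `agreeCountR` verbatim from line `product`; `elimFailBits`/`elimFail` are the
cell's (`Elimination.lean`, identical text).
-/

namespace Summit.QuantumAdvantage.AdviceFreeQNC0

open Finset Literature.Computability.MetaComplexity Literature.Computability.MetaComplexity.Smolensky

variable {L L' : ℕ}

/-! ### Vocabulary (verbatim from line `product`) -/

/-- `h` is the WIN pattern of some stakes-eliminator of degree `≤ D` (any target class) — the
elimination code `C_ℓ(D)`. -/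
def IsElimWin {ℓ : ℕ} (D : ℕ) (h : (Fin ℓ → Bool) → Bool) : Prop :=
  ∃ c : ℕ, ∃ a b : (Fin ℓ → Bool) → Bool, HasDeg a D ∧ HasDeg b D ∧ ∀ u, h u = !(elimFail c a b u)

/-- agreements of an `L × L'` pair of block patterns. -/
def agreeCountR (X Y : (Fin L → Bool) → (Fin L' → Bool) → Bool) : ℕ :=
  (univ.filter fun p : (Fin L → Bool) × (Fin L' → Bool) => X p.1 p.2 = Y p.1 p.2).card

/-! ### The two members' success patterns -/

/-- Member 0's success in row `u`: the WIN pattern of the stakes-eliminator `F₀ u` of class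
`2(c + |u|)` on block `L'`. -/
def win0 (c : ℕ) (F₀ : (Fin L → Bool) → (Fin L' → Bool) → T4) (u : Fin L → Bool) (v : Fin L' → Bool) : Bool :=
  !(elimFail (2 * (c + wt u)) (fun v => (F₀ u v).1) (fun v => (F₀ u v).2) v)

/-- Member 1's success in column `v`: the WIN pattern of the stakes-eliminator `(a' ⊕ b', b')`,
`(a', b') = F₁ v`, of class `c + |v|` on block `L`. -/
def win1 (c : ℕ) (F₁ : (Fin L' → Bool) → (Fin L → Bool) → T4) (u : Fin L → Bool) (v : Fin L' → Bool) : Bool :=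
  !(elimFail (c + wt v) (fun u => xor (F₁ v u).1 (F₁ v u).2) (fun u => (F₁ v u).2) u)

/-! ### The three-mode XOR law -/

/-- `elimFailBits` depends on the class and the weight only modulo `3`. -/
theorem elimFailBits_mod (c : ℕ) (α β : Bool) (w : ℕ) :
    elimFailBits c α β w = elimFailBits (c % 3) α β (w % 3) := by
  unfold elimFailBits
  simp only [Nat.mod_mod]

/-- `tOmegaPow` depends on the exponent only modulo `3`. -/
theorem tOmegaPow_mod (m : ℕ) (p : T4) : tOmegaPow m p = tOmegaPow (m % 3) p := by
  unfold tOmegaPow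
  rw [Nat.mod_mod]

/-- The law on residues (finite check: `3³ · 4²` cases). -/
private theorem xor_law_residues :
    ∀ r s t : Fin 3, ∀ p q : T4,
      ((t4add p (tOmegaPow s.val q) ≠ (false, false) ∧
          t4add p (tOmegaPow s.val q) ≠ tOmegaPow ((2 * (r.val + s.val + t.val)) % 3) (true, false)) ↔
        (!elimFailBits ((r.val + t.val) % 3) (xor q.1 q.2) q.2 s.val) ≠
          (!elimFailBits ((2 * (r.val + s.val)) % 3) p.1 p.2 t.val)) := by
  decide

/-- **Three-mode XOR law** (p2 §9.26): a cell is WON by the cross team iff exactly one member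
succeeds. -/
theorem crossWin_iff_ne (c : ℕ) (F₀ : (Fin L → Bool) → (Fin L' → Bool) → T4)
    (F₁ : (Fin L' → Bool) → (Fin L → Bool) → T4) (u : Fin L → Bool) (v : Fin L' → Bool) :
    crossWin c F₀ F₁ u v = true ↔ win1 c F₁ u v ≠ win0 c F₀ u v := by
  unfold crossWin win0 win1 elimFail
  simp only [decide_eq_true_eq]
  rw [tOmegaPow_mod (wt u), tOmegaPow_mod (2 * (c + wt u + wt v)),
    elimFailBits_mod (c + wt v), elimFailBits_mod (2 * (c + wt u))]
  have h1 : (2 * (c + wt u + wt v)) % 3 = (2 * (c % 3 + wt u % 3 + wt v % 3)) % 3 := by omega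
  have h2 : (c + wt v) % 3 = (c % 3 + wt v % 3) % 3 := by omega
  have h3 : (2 * (c + wt u)) % 3 = (2 * (c % 3 + wt u % 3)) % 3 := by omega
  rw [h1, h2, h3]
  exact xor_law_residues ⟨c % 3, Nat.mod_lt _ (by norm_num)⟩ ⟨wt u % 3, Nat.mod_lt _ (by norm_num)⟩
    ⟨wt v % 3, Nat.mod_lt _ (by norm_num)⟩ _ _

/-- **Won cells plus lost cells**: `crossWinCount + agreeCountR win1 win0 = 2^{L+L'}`. -/
theorem crossWinCount_add_agree (c : ℕ) (F₀ : (Fin L → Bool) → (Fin L' → Bool) → T4)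
    (F₁ : (Fin L' → Bool) → (Fin L → Bool) → T4) :
    crossWinCount c F₀ F₁ + agreeCountR (win1 c F₁) (win0 c F₀) = 2 ^ (L + L') := by
  unfold crossWinCount agreeCountR
  have hset : (univ.filter fun p : (Fin L → Bool) × (Fin L' → Bool) => crossWin c F₀ F₁ p.1 p.2 = true) =
      univ.filter fun p : (Fin L → Bool) × (Fin L' → Bool) => ¬ (win1 c F₁ p.1 p.2 = win0 c F₀ p.1 p.2) := by
    ext p
    simp only [mem_filter, mem_univ, true_and, crossWin_iff_ne]
  rw [hset, add_comm, Finset.card_filter_add_card_filter_not, card_univ, Fintype.card_prod,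
    Fintype.card_fun, Fintype.card_fun, Fintype.card_bool, Fintype.card_fin, Fintype.card_fin,
    pow_add]

/-! ### The success patterns are elimination win patterns -/

/-- Member 0's rows are win patterns of degree-`≤ D` stakes-eliminators. -/
theorem isElimWin_win0 {D : ℕ} (c : ℕ) {F₀ : (Fin L → Bool) → (Fin L' → Bool) → T4}
    (hF : CrossDeg D F₀) (u : Fin L → Bool) : IsElimWin D (fun v => win0 c F₀ u v) :=
  ⟨2 * (c + wt u), _, _, (hF u).1, (hF u).2, fun _ => rfl⟩

/-- Member 1's columns are win patterns of degree-`≤ D` stakes-eliminators (Frobenius twist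
`(a', b') ↦ (a' ⊕ b', b')` preserves the degree). -/
theorem isElimWin_win1 {D : ℕ} (c : ℕ) {F₁ : (Fin L' → Bool) → (Fin L → Bool) → T4}
    (hF : CrossDeg D F₁) (v : Fin L' → Bool) : IsElimWin D (fun u => win1 c F₁ u v) :=
  ⟨c + wt v, _, _, hasDeg_xor (hF v).1 (hF v).2, (hF v).2, fun _ => rfl⟩

/-! ### The stub -/

/-- **`stub_crossToProduct`, all `L, L'`: hardness of the product game implies hardness of the
cross-team game**, `θ = 1 − μ` (bodies of `ProductHardPolylog` and `CrossTeamHardPolylog`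
verbatim). -/
theorem crossTeamHard_of_productHard
    (h : ∃ μ : ℝ, 0 < μ ∧ ∀ C : ℕ, ∃ L₀ : ℕ, ∀ L L' : ℕ, L₀ ≤ L → L₀ ≤ L' →
      ∀ X Y : (Fin L → Bool) → (Fin L' → Bool) → Bool,
        (∀ v, IsElimWin ((Nat.log 2 (min L L')) ^ C) (fun u => X u v)) →
        (∀ u, IsElimWin ((Nat.log 2 (min L L')) ^ C) (fun v => Y u v)) →
          μ * (2 : ℝ) ^ (L + L') ≤ (agreeCountR X Y : ℝ)) :
    ∃ θ : ℝ, θ < 1 ∧ ∀ C : ℕ, ∃ L₀ : ℕ, ∀ L L' : ℕ, L₀ ≤ L → L₀ ≤ L' →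
      ∀ c : ℕ, ∀ F₀ : (Fin L → Bool) → (Fin L' → Bool) → T4,
        ∀ F₁ : (Fin L' → Bool) → (Fin L → Bool) → T4,
          CrossDeg ((Nat.log 2 (min L L')) ^ C) F₀ → CrossDeg ((Nat.log 2 (min L L')) ^ C) F₁ →
            (crossWinCount c F₀ F₁ : ℝ) ≤ θ * (2 : ℝ) ^ (L + L') := by
  obtain ⟨μ, hμ, hP⟩ := h
  refine ⟨1 - μ, by linarith, fun C => ?_⟩
  obtain ⟨L₀, hL₀⟩ := hP C
  refine ⟨L₀, fun L L' hL hL' c F₀ F₁ hF₀ hF₁ => ?_⟩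
  have hagree := hL₀ L L' hL hL' (win1 c F₁) (win0 c F₀) (isElimWin_win1 c hF₁) (isElimWin_win0 c hF₀)
  have htot : (crossWinCount c F₀ F₁ : ℝ) + (agreeCountR (win1 c F₁) (win0 c F₀) : ℝ) = (2 : ℝ) ^ (L + L') := by
    exact_mod_cast crossWinCount_add_agree c F₀ F₁
  linarith

end Summit.QuantumAdvantage.AdviceFreeQNC0
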